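import Mathlib.MeasureTheory.Integral.Prod
import Mathlib.MeasureTheory.Integral.IntervalIntegral.FundThmCalculus
import Literature.MathematicalPhysics.KineticTheory.InfiniteChainObservables
import Literature.MathematicalPhysics.KineticTheory.InfiniteChainSeveredGibbs
import HarnessLib

/-!
# Gibbs states of the infinite chain are time invariant in the generator sense

Topic `Literature/MathematicalPhysics/KineticTheory`; theorems only (no definitions, no named facts).

Lanford–Lebowitz–Lieb 1977, §4 remark (i) ("by conservation of energy and Liouville's theorem, any
Gibbs state is invariant under `T_t^α` for all `α, t`"; in the tree:
`OscillatorChain.measurePreserving_severedFlow_of_isChainGibbsMeasure`, `InfiniteChainSeveredGibbs`)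
is upgraded to Bernardin's generator form of time invariance (Bernardin 2014, §1.1, Def. 1,
footnote: "`ν` is time invariant for the infinite dynamics iff `∫ 𝒜f dν = 0` for any `f ∈ C₀¹`";
tree: `IsTimeInvariant`, `InfiniteChainInvariantStates`): **every DLR Gibbs state `μ` of a chain
with `C²` potentials obeying LLL's condition B1 satisfies `∫ 𝒜f dμ = 0` for every local test
function `f` with `𝒜f ∈ L¹(μ)`** — no infinite-volume dynamics is needed.

Proof (no dominated convergence): for `f = g ∘ box_{a,n}` take `Λ = {a, …, a+n}`; along a severed
orbit `t ↦ T_t^Λ σ` the particles of `Λ` move under the FULL force, so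
`d/dt f(T_t^Λ σ) = (𝒜f)(T_t^Λ σ)` (chain rule; `𝒜f` only differentiates in the box) and
`f(T_1^Λ σ) - f(σ) = ∫_0^1 (𝒜f)(T_s^Λ σ) ds`. Integrating `dμ(σ)`, Fubini (joint measurability of
`(s, σ) ↦ T_s^Λ σ`, `measurable_severedFlow_uncurry`; the `L¹` bound is `∫|𝒜f| dμ` at every `s` by
invariance) and `T_s^Λ`-invariance of `μ` give
`∫ 𝒜f dμ = ∫_0^1 ∫ (𝒜f) ∘ T_s^Λ dμ ds = ∫ (f ∘ T_1^Λ - f) dμ = 0`.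

## Contents

* `IsSeveredSolution.hasDerivAt_comp_boxRestrictAt` — the chain rule along severed solutions;
* `continuous_liouvilleZ_severedFlow`, `integral_liouvilleZ_severedFlow_eq_sub` — continuity of
  `s ↦ (𝒜f)(T_s σ)` and the fundamental theorem of calculus along the severed flow;
* `IsChainGibbsMeasure.integral_liouvilleZ_eq_zero` — **main**: `∫ 𝒜f dμ = 0` for `f ∈ C₀¹` with
  `𝒜f ∈ L¹(μ)`;
* `IsChainGibbsMeasure.isTimeInvariant` — a Gibbs state with integrable momenta and forces is
  `IsTimeInvariant` (the integrability conjunct of `IsTimeInvariant` from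
  `IsLocalTestFunction.exists_abs_liouvilleZ_le`).

[cite: LanfordLebowitzLieb1977, §4 remark (i)] [cite: Bernardin2014, §1.1 Def. 1 footnote]
-/

noncomputable section

open MeasureTheory Filter Topology Set
open scoped ENNReal

namespace Literature.MathematicalPhysics.KineticTheory.HeatConduction

namespace OscillatorChain

variable {P : OscillatorChain}

/-! ### The chain rule along severed solutions -/

omit P in
/-- The sites `a + i`, `i ≤ n`, lie in the box `{a, …, a+n}`. [folklore] -/
theorem add_coe_mem_Icc (a : ℤ) (n : ℕ) (i : Fin (n + 1)) :
    a + (i : ℤ) ∈ Finset.Icc a (a + n) := by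
  have hi := i.isLt
  rw [Finset.mem_Icc]
  constructor <;> omega

omit P in
/-- A vector of the box space is the sum of its coordinate components along `e_i^q`, `e_i^p`.
[folklore] -/
theorem pi_eq_sum_smul_single {n : ℕ} (v : Fin (n + 1) → ℝ × ℝ) :
    v = ∑ i : Fin (n + 1), ((v i).1 • (Pi.single i ((1 : ℝ), (0 : ℝ)) : Fin (n + 1) → ℝ × ℝ) +
      (v i).2 • (Pi.single i ((0 : ℝ), (1 : ℝ)) : Fin (n + 1) → ℝ × ℝ)) := by
  conv_lhs => rw [← Finset.univ_sum_single v]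
  refine Finset.sum_congr rfl fun i _ => ?_
  rw [← Pi.single_smul', ← Pi.single_smul', ← Pi.single_add]
  congr 1
  ext <;> simp

/-- **Chain rule along a severed solution.** If `γ` solves the severed equations (9a)–(9c) in a
region `Λ` containing the box `{a, …, a+n}` and `g` is differentiable, then
`d/dt g(box_{a,n}(γ t)) = 𝒜(g ∘ box_{a,n})(γ t)`: inside `Λ` the particles move under the full
force, and `𝒜(g ∘ box)` only differentiates in the box. [folklore] -/
theorem IsSeveredSolution.hasDerivAt_comp_boxRestrictAt {Λ : Finset ℤ} {γ : ℝ → ChainConfig}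
    (hγ : P.IsSeveredSolution Λ γ) (a : ℤ) (n : ℕ) (hΛ : ∀ i : Fin (n + 1), a + (i : ℤ) ∈ Λ)
    {g : (Fin (n + 1) → ℝ × ℝ) → ℝ} (hg : Differentiable ℝ g) (t : ℝ) :
    HasDerivAt (fun s => g (boxRestrictAt a n (γ s)))
      (liouvilleZ P (g ∘ boxRestrictAt a n) (γ t)) t := by
  have hc : HasDerivAt (fun s => boxRestrictAt a n (γ s))
      (fun i => ((γ t (a + i)).2, P.force (γ t) (a + i))) t := by
    rw [hasDerivAt_pi]
    intro i
    exact ((hγ.1 (a + i) (hΛ i) t).1).prodMk ((hγ.1 (a + i) (hΛ i) t).2)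
  have hcomp := ((hg (boxRestrictAt a n (γ t))).hasFDerivAt).comp_hasDerivAt t hc
  have hv : (fun i : Fin (n + 1) => ((γ t (a + (i : ℤ))).2, P.force (γ t) (a + (i : ℤ)))) =
      ∑ i : Fin (n + 1), ((γ t (a + i)).2 • (Pi.single i ((1 : ℝ), (0 : ℝ)) : Fin (n + 1) → ℝ × ℝ) +
        P.force (γ t) (a + i) • (Pi.single i ((0 : ℝ), (1 : ℝ)) : Fin (n + 1) → ℝ × ℝ)) :=
    pi_eq_sum_smul_single _
  have heq : fderiv ℝ g (boxRestrictAt a n (γ t)) (fun i => ((γ t (a + i)).2, P.force (γ t) (a + i))) =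
      liouvilleZ P (g ∘ boxRestrictAt a n) (γ t) := by
    rw [hv, map_sum, liouvilleZ_comp_boxRestrictAt P a n (γ t) (hg _)]
    refine Finset.sum_congr rfl fun i _ => ?_
    rw [map_add, map_smul, map_smul, smul_eq_mul, smul_eq_mul]
  rw [← heq]
  exact hcomp

/-! ### Along the severed flow: continuity and the fundamental theorem of calculus -/

/-- The force at a site is continuous along a continuous curve of configurations (`U, V ∈ C²`).
[folklore] -/
theorem continuous_force_comp (hU : ContDiff ℝ 2 P.U) (hV : ContDiff ℝ 2 P.V) {γ : ℝ → ChainConfig}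
    (hγ : Continuous γ) (x : ℤ) : Continuous fun s => P.force (γ s) x := by
  have hU' : Continuous (deriv P.U) := hU.continuous_deriv (by norm_num)
  have hV' : Continuous (deriv P.V) := hV.continuous_deriv (by norm_num)
  have hq : ∀ y : ℤ, Continuous fun s => (γ s y).1 := fun y =>
    continuous_fst.comp ((continuous_apply y).comp hγ)
  simp only [force_eq]
  exact ((hU'.comp (hq x)).neg.add (hV'.comp ((hq (x + 1)).sub (hq x)))).sub
    (hV'.comp ((hq x).sub (hq (x - 1))))

/-- **Continuity of `s ↦ (𝒜f)(T_s^Λ σ)`** for `f = g ∘ box_{a,n}`, `g ∈ C¹`, along the severed flow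
in `Λ = {a, …, a+n}`. [folklore] -/
theorem continuous_liouvilleZ_severedFlow (hU : ContDiff ℝ 2 P.U) (hV : ContDiff ℝ 2 P.V)
    (hB1 : P.CondB1) (a : ℤ) (n : ℕ) {g : (Fin (n + 1) → ℝ × ℝ) → ℝ} (hg : ContDiff ℝ 1 g)
    (σ : ChainConfig) :
    Continuous fun s => liouvilleZ P (g ∘ boxRestrictAt a n)
      (severedFlow hB1 (Finset.Icc a (a + n)) s σ) := by
  have hγ := continuous_severedFlow_curve hB1 (Finset.Icc a (a + n)) σ
  have hgd : Differentiable ℝ g := hg.differentiable one_ne_zero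
  have heq : (fun s => liouvilleZ P (g ∘ boxRestrictAt a n) (severedFlow hB1 (Finset.Icc a (a + n)) s σ)) =
      fun s => ∑ i : Fin (n + 1),
        ((severedFlow hB1 (Finset.Icc a (a + n)) s σ (a + i)).2 *
          fderiv ℝ g (boxRestrictAt a n (severedFlow hB1 (Finset.Icc a (a + n)) s σ)) (Pi.single i (1, 0)) +
        P.force (severedFlow hB1 (Finset.Icc a (a + n)) s σ) (a + i) *
          fderiv ℝ g (boxRestrictAt a n (severedFlow hB1 (Finset.Icc a (a + n)) s σ)) (Pi.single i (0, 1))) :=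
    funext fun s => liouvilleZ_comp_boxRestrictAt P a n _ (hgd _)
  rw [heq]
  have hbox : Continuous fun s => boxRestrictAt a n (severedFlow hB1 (Finset.Icc a (a + n)) s σ) :=
    continuous_pi fun i => (continuous_apply (a + (i : ℤ))).comp hγ
  have hD : ∀ v : Fin (n + 1) → ℝ × ℝ, Continuous fun s =>
      fderiv ℝ g (boxRestrictAt a n (severedFlow hB1 (Finset.Icc a (a + n)) s σ)) v := fun v =>
    ((ContinuousLinearMap.apply ℝ ℝ v).continuous.comp (hg.continuous_fderiv one_ne_zero)).comp hbox
  refine continuous_finsetSum _ fun i _ => ?_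
  exact ((continuous_snd.comp ((continuous_apply (a + (i : ℤ))).comp hγ)).mul (hD _)).add
    ((continuous_force_comp hU hV hγ _).mul (hD _))

/-- **Fundamental theorem of calculus along the severed flow**: for `f = g ∘ box_{a,n}`, `g ∈ C¹`,
and `Λ = {a, …, a+n}`, `∫_0^t (𝒜f)(T_s^Λ σ) ds = f(T_t^Λ σ) - f(σ)`. [folklore] -/
theorem integral_liouvilleZ_severedFlow_eq_sub (hU : ContDiff ℝ 2 P.U) (hV : ContDiff ℝ 2 P.V)
    (hB1 : P.CondB1) (a : ℤ) (n : ℕ) {g : (Fin (n + 1) → ℝ × ℝ) → ℝ} (hg : ContDiff ℝ 1 g)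
    (σ : ChainConfig) (t : ℝ) :
    ∫ s in (0 : ℝ)..t, liouvilleZ P (g ∘ boxRestrictAt a n) (severedFlow hB1 (Finset.Icc a (a + n)) s σ) =
      g (boxRestrictAt a n (severedFlow hB1 (Finset.Icc a (a + n)) t σ)) - g (boxRestrictAt a n σ) := by
  have hγ := isSeveredSolution_severedFlow hB1 (Finset.Icc a (a + n)) σ
  have hderiv : ∀ s : ℝ, HasDerivAt (fun s => g (boxRestrictAt a n (severedFlow hB1 (Finset.Icc a (a + n)) s σ)))
      (liouvilleZ P (g ∘ boxRestrictAt a n) (severedFlow hB1 (Finset.Icc a (a + n)) s σ)) s := fun s =>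
    hγ.hasDerivAt_comp_boxRestrictAt a n (add_coe_mem_Icc a n) (hg.differentiable one_ne_zero) s
  rw [intervalIntegral.integral_eq_sub_of_hasDerivAt (fun s _ => hderiv s)
    ((continuous_liouvilleZ_severedFlow hU hV hB1 a n hg σ).intervalIntegrable _ _)]
  simp

/-! ### The main theorem -/

/-- Invariance in Bochner form: `∫ F ∘ T_t^Λ dμ = ∫ F dμ` for measurable real `F` and any Gibbs
state `μ` (no integrability needed: both sides are the same Bochner integral after `map`).
[cite: LanfordLebowitzLieb1977, §4 remark (i)] -/
theorem integral_comp_severedFlow_of_isChainGibbsMeasure (hU : ContDiff ℝ 2 P.U)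
    (hV : ContDiff ℝ 2 P.V) (hB1 : P.CondB1) (Λ : Finset ℤ) {T : ℝ} {μ : Measure ChainConfig}
    (hμ : P.IsChainGibbsMeasure T μ) (t : ℝ) {F : ChainConfig → ℝ} (hF : Measurable F) :
    ∫ σ, F (severedFlow hB1 Λ t σ) ∂μ = ∫ σ, F σ ∂μ := by
  have h := measurePreserving_severedFlow_of_isChainGibbsMeasure hU hV hB1 Λ hμ t
  rw [← integral_map h.measurable.aemeasurable hF.aestronglyMeasurable, h.map_eq]

/-- **Gibbs states are stationary in the generator sense, box form.** Let `U, V ∈ C²`, let the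
severed dynamics exist globally (B1), and let `μ` be a DLR Gibbs state of the chain at temperature
`T`. Then `∫ 𝒜(g ∘ box_{a,n}) dμ = 0` for every bounded `C¹` profile `g` on the box `{a, …, a+n}`
with `𝒜(g ∘ box_{a,n})` measurable and `μ`-integrable. [cite: LanfordLebowitzLieb1977, §4 remark (i)] -/
theorem IsChainGibbsMeasure.integral_liouvilleZ_comp_boxRestrictAt_eq_zero (hU : ContDiff ℝ 2 P.U)
    (hV : ContDiff ℝ 2 P.V) (hB1 : P.CondB1) {T : ℝ} {μ : Measure ChainConfig}
    (hμ : P.IsChainGibbsMeasure T μ) (a : ℤ) (n : ℕ) {g : (Fin (n + 1) → ℝ × ℝ) → ℝ}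
    (hg : ContDiff ℝ 1 g) (hbd : ∃ M : ℝ, ∀ y, |g y| ≤ M)
    (hFm : Measurable (liouvilleZ P (g ∘ boxRestrictAt a n)))
    (hint : Integrable (liouvilleZ P (g ∘ boxRestrictAt a n)) μ) :
    ∫ σ, liouvilleZ P (g ∘ boxRestrictAt a n) σ ∂μ = 0 := by
  haveI : IsProbabilityMeasure μ := hμ.isProbabilityMeasure
  obtain ⟨M, hM⟩ := hbd
  have hfm : Measurable (g ∘ boxRestrictAt a n) :=
    hg.continuous.measurable.comp (boxRestrictAt_measurable a n)
  set Λ : Finset ℤ := Finset.Icc a (a + n) with hΛ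
  -- (A) invariance at every time, for `𝒜f` and for `f`
  have hA : ∀ s : ℝ, ∫ σ, liouvilleZ P (g ∘ boxRestrictAt a n) (severedFlow hB1 Λ s σ) ∂μ =
      ∫ σ, liouvilleZ P (g ∘ boxRestrictAt a n) σ ∂μ := fun s =>
    integral_comp_severedFlow_of_isChainGibbsMeasure hU hV hB1 Λ hμ s hFm
  have hA' : ∫ σ, (g ∘ boxRestrictAt a n) (severedFlow hB1 Λ 1 σ) ∂μ =
      ∫ σ, (g ∘ boxRestrictAt a n) σ ∂μ :=
    integral_comp_severedFlow_of_isChainGibbsMeasure hU hV hB1 Λ hμ 1 hfm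
  -- (B) FTC along the severed orbits
  have hB : ∀ σ : ChainConfig, ∫ s in (0 : ℝ)..1, liouvilleZ P (g ∘ boxRestrictAt a n) (severedFlow hB1 Λ s σ) =
      (g ∘ boxRestrictAt a n) (severedFlow hB1 Λ 1 σ) - (g ∘ boxRestrictAt a n) σ := fun σ =>
    integral_liouvilleZ_severedFlow_eq_sub hU hV hB1 a n hg σ 1
  -- (C) integrability on `[0, 1] × Ω`
  have hmeasU : Measurable fun p : ℝ × ChainConfig =>
      liouvilleZ P (g ∘ boxRestrictAt a n) (severedFlow hB1 Λ p.1 p.2) :=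
    hFm.comp (measurable_severedFlow_uncurry hB1 Λ hU hV)
  have hC' : Integrable (fun p : ℝ × ChainConfig =>
      liouvilleZ P (g ∘ boxRestrictAt a n) (severedFlow hB1 Λ p.1 p.2))
      ((volume.restrict (Ioc (0 : ℝ) 1)).prod μ) := by
    refine ⟨hmeasU.aestronglyMeasurable, ?_⟩
    unfold HasFiniteIntegral
    rw [lintegral_prod _ hmeasU.enorm.aemeasurable]
    have hinner : ∀ s : ℝ, ∫⁻ σ, ‖liouvilleZ P (g ∘ boxRestrictAt a n) (severedFlow hB1 Λ s σ)‖ₑ ∂μ =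
        ∫⁻ σ, ‖liouvilleZ P (g ∘ boxRestrictAt a n) σ‖ₑ ∂μ := fun s =>
      lintegral_comp_severedFlow_of_isChainGibbsMeasure hU hV hB1 Λ hμ s hFm.enorm
    simp only [hinner, lintegral_const, Measure.restrict_apply_univ, Real.volume_Ioc, sub_zero,
      ENNReal.ofReal_one, mul_one]
    exact hint.2
  have hC : Integrable (Function.uncurry fun (s : ℝ) (σ : ChainConfig) =>
      liouvilleZ P (g ∘ boxRestrictAt a n) (severedFlow hB1 Λ s σ))
      ((volume.restrict (Ioc (0 : ℝ) 1)).prod μ) := hC'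
  -- (D) Fubini, and evaluation of both iterated integrals
  have hD := integral_integral_swap hC
  have hL : ∫ s in Ioc (0 : ℝ) 1, ∫ σ, liouvilleZ P (g ∘ boxRestrictAt a n) (severedFlow hB1 Λ s σ) ∂μ =
      ∫ σ, liouvilleZ P (g ∘ boxRestrictAt a n) σ ∂μ := by
    simp only [hA, setIntegral_const, Real.volume_real_Ioc, sub_zero, max_eq_left zero_le_one,
      one_smul]
  have hR : ∫ σ, (∫ s in Ioc (0 : ℝ) 1,
      liouvilleZ P (g ∘ boxRestrictAt a n) (severedFlow hB1 Λ s σ)) ∂μ = 0 := by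
    have hpt : ∀ σ, ∫ s in Ioc (0 : ℝ) 1, liouvilleZ P (g ∘ boxRestrictAt a n) (severedFlow hB1 Λ s σ) =
        (g ∘ boxRestrictAt a n) (severedFlow hB1 Λ 1 σ) - (g ∘ boxRestrictAt a n) σ := fun σ => by
      rw [← intervalIntegral.integral_of_le zero_le_one, hB σ]
    simp only [hpt]
    have h1 : Integrable (fun σ => (g ∘ boxRestrictAt a n) (severedFlow hB1 Λ 1 σ)) μ := by
      refine Integrable.of_bound
        ((hfm.comp (measurable_severedFlow hB1 Λ hU hV 1)).aestronglyMeasurable) M ?_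
      exact Eventually.of_forall fun σ => by
        simpa [Real.norm_eq_abs] using hM (boxRestrictAt a n (severedFlow hB1 Λ 1 σ))
    have h2 : Integrable (g ∘ boxRestrictAt a n) μ :=
      Integrable.of_bound hfm.aestronglyMeasurable M
        (Eventually.of_forall fun σ => by simpa [Real.norm_eq_abs] using hM (boxRestrictAt a n σ))
    rw [integral_sub h1 h2, hA', sub_self]
  rw [← hL, hD, hR]

/-- **Gibbs states are stationary in the generator sense** (LLL 1977 §4 remark (i) ⇒ Bernardin
2014 Def. 1 footnote). Let `U, V ∈ C²`, let the severed dynamics exist globally (B1), and let `μ`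
be a DLR Gibbs state of the chain at temperature `T`. Then `∫ 𝒜f dμ = 0` for every local test
function `f ∈ C₀¹` whose `𝒜f` is `μ`-integrable. [cite: LanfordLebowitzLieb1977, §4 remark (i)] -/
theorem IsChainGibbsMeasure.integral_liouvilleZ_eq_zero (hU : ContDiff ℝ 2 P.U)
    (hV : ContDiff ℝ 2 P.V) (hB1 : P.CondB1) {T : ℝ} {μ : Measure ChainConfig}
    (hμ : P.IsChainGibbsMeasure T μ) {f : ChainConfig → ℝ} (hf : IsLocalTestFunction f)
    (hint : Integrable (liouvilleZ P f) μ) :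
    ∫ σ, liouvilleZ P f σ ∂μ = 0 := by
  have hFm : Measurable (liouvilleZ P f) := hf.measurable_liouvilleZ P
  obtain ⟨R, g, hg, hbd, -, rfl⟩ := hf
  rw [boxRestrict_eq_boxRestrictAt] at hFm hint ⊢
  exact hμ.integral_liouvilleZ_comp_boxRestrictAt_eq_zero hU hV hB1 _ _ hg hbd hFm hint

/-! ### Time invariance -/

/-- **A Gibbs state with integrable momenta and forces is time invariant** in the generator sense
of Bernardin 2014, Def. 1 (`IsTimeInvariant`: `𝒜f ∈ L¹(μ)` and `∫ 𝒜f dμ = 0` for all `f ∈ C₀¹`).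
The integrability of `𝒜f` comes from `|𝒜f| ≤ C ∑_box (|p_x| + |F_x|)`
(`IsLocalTestFunction.exists_abs_liouvilleZ_le`). [cite: Bernardin2014, §1.1 Def. 1 footnote] -/
theorem IsChainGibbsMeasure.isTimeInvariant (hU : ContDiff ℝ 2 P.U) (hV : ContDiff ℝ 2 P.V)
    (hB1 : P.CondB1) {T : ℝ} {μ : Measure ChainConfig} (hμ : P.IsChainGibbsMeasure T μ)
    (hp : ∀ x : ℤ, Integrable (fun σ : ChainConfig => (σ x).2) μ)
    (hF : ∀ x : ℤ, Integrable (fun σ : ChainConfig => P.force σ x) μ) :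
    IsTimeInvariant P μ := by
  intro f hf
  have hint : Integrable (liouvilleZ P f) μ := by
    obtain ⟨R, C, -, hC⟩ := hf.exists_abs_liouvilleZ_le P
    have hdom : Integrable (fun σ : ChainConfig => C * ∑ i : Fin (2 * R + 1),
        (|(σ ((i : ℤ) - R)).2| + |P.force σ ((i : ℤ) - R)|)) μ :=
      (integrable_finsetSum _ fun i _ => ((hp _).abs.add (hF _).abs)).const_mul C
    refine hdom.mono' (hf.measurable_liouvilleZ P).aestronglyMeasurable
      (Eventually.of_forall fun σ => ?_)
    rw [Real.norm_eq_abs]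
    exact hC σ
  exact ⟨hint, hμ.integral_liouvilleZ_eq_zero hU hV hB1 hf hint⟩

end OscillatorChain

end Literature.MathematicalPhysics.KineticTheory.HeatConduction

end
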